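import Summits.CriticalPhenomena.SAWScalingLimit.Theses.SAWLaplacianWalk
import Summits.CriticalPhenomena.SAWScalingLimit.Theorems.SAWLoopFugacityFlowAssembly

/-!
# Route SAWLaplacianWalk, support item `SlitFirstStep` (stmt-CriticalPhenomena-4484)

First-step decomposition of the slit SAW mass. For a bounded `Ω`, a mesh `δ > 0`, a finite list `S`
of forbidden sites ("the past") containing the tip `w`, and a target `c ≠ w`, write
`Z_{u,S'}(c) := Σ_{ω : u → c SAW of Ω_δ, ω(0,|ω|] ∩ S' = ∅} x_c^{|ω|}` (an `ℝ`-valued `tsum` over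
`SAW.DomainSAW Ω δ u c`). Then

`Z_{w,S}(c) = x_c · Σ_{u ∼ w, u ∉ S} Z_{u, u::S}(c)`,

the identity that makes the target-switching ratio `Z_η(d)/Z_η(b)` an exact martingale
(Lawler 2005, (0.1) with the harmonic `q` replaced by the SAW masses `q*`).

Proof. All SAW spaces `SAW.DomainSAW Ω δ · c` are finite for bounded `Ω` and `δ > 0`
(`SAWLoopFugacityFlowAssembly.finite_domainSAW`, reused), and the
admissible neighbours `u` of `w` lie in the finite set `Ω_δ`, so every sum is a finite sum. The
identity is the bijection `(u, ω') ↦ w·ω'` between pairs (neighbour `u ∉ S` of `w`, SAW `ω' : u → c`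
with `ω'(0,|ω'|] ∩ S = ∅`) and SAWs `ω : w → c` with `ω(0,|ω|] ∩ S = ∅` (`w ∉ ω'` because `w ∈ S`
and `u ≠ w`; a SAW from `u` never revisits `u`, so avoiding `u :: S` after time `0` is the same as
avoiding `S`), with `x_c^{|w·ω'|} = x_c · x_c^{|ω'|}`; formally `Function.Injective.tsum_eq`,
`Summable.tsum_sigma'` and `tsum_subtype`. Everything here is proved; no named facts are used.
[folklore]
-/

namespace Summit.CriticalPhenomena.SAWScalingLimit.Theorems

open Literature.Probability.LatticeModels Literature.Probability.RandomPlanarGeometry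

namespace SAWLaplacianWalkSlitFirstStep

open scoped Classical in
/-- **First-step decomposition of the slit SAW mass** (explicit form of `SlitFirstStep`): for a
bounded `Ω`, `δ > 0`, `w ∈ S` and `w ≠ c`,
`Σ_{ω : w → c, ω(0,·] ∩ S = ∅} x_c^{|ω|} = x_c · Σ_{u ∼ w, u ∉ S} Σ_{ω' : u → c, ω'(0,·] ∩ (u::S) = ∅} x_c^{|ω'|}`,
by the bijection `(u, ω') ↦ w·ω'`. [folklore] -/
theorem tsum_firstStep {Ω : Set ℂ} {δ : ℝ} (hΩ : Bornology.IsBounded Ω) (hδ : 0 < δ)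
    {w c : Site 2} {S : List (Site 2)} (hwS : w ∈ S) (hwc : w ≠ c) :
    (∑' ω : SAW.DomainSAW Ω δ w c,
        if ∀ v ∈ ω.walk.support.tail, v ∉ S then SAW.criticalFugacity ^ ω.length else 0) =
      SAW.criticalFugacity * ∑ᶠ u ∈ {u | (discreteDomainGraph Ω δ).Adj w u ∧ u ∉ S},
        ∑' ω : SAW.DomainSAW Ω δ u c,
          if ∀ v ∈ ω.walk.support.tail, v ∉ u :: S then SAW.criticalFugacity ^ ω.length else 0 := by
  -- abbreviations
  set G : SimpleGraph (Site 2) := discreteDomainGraph Ω δ with hG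
  set x : ℝ := SAW.criticalFugacity with hx
  set N : Set (Site 2) := {u | G.Adj w u ∧ u ∉ S} with hNdef
  -- the slit mass with past `S'` from `u`
  let Z : Site 2 → List (Site 2) → ℝ := fun u S' => ∑' ω : SAW.DomainSAW Ω δ u c,
    if ∀ v ∈ ω.walk.support.tail, v ∉ S' then x ^ ω.length else 0
  -- finiteness
  haveI hfinSAW : ∀ u : Site 2, Finite (SAW.DomainSAW Ω δ u c) := fun u =>
    SAWLoopFugacityFlowAssembly.finite_domainSAW hΩ hδ u c
  have hN : N.Finite :=
    (meshDomain_finite hΩ hδ).subset fun u hu => (discreteDomainGraph_adj_iff.1 hu.1).2.2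
  haveI : Finite N := hN.to_subtype
  -- the index type of the right-hand side and the "prepend the first edge" map `Φ`
  let I := Σ u : N, {ω' : SAW.DomainSAW Ω δ u.1 c // ∀ v ∈ ω'.walk.support.tail, v ∉ S}
  haveI : Finite I := by
    show Finite (Σ u : N, {ω' : SAW.DomainSAW Ω δ u.1 c // ∀ v ∈ ω'.walk.support.tail, v ∉ S})
    infer_instance
  have hnotin : ∀ p : I, w ∉ p.2.1.walk.support := by
    rintro ⟨⟨u, hu⟩, ⟨ω', hω'⟩⟩ hmem
    rw [← SimpleGraph.Walk.cons_tail_support, List.mem_cons] at hmem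
    rcases hmem with rfl | hmem
    · exact hu.2 hwS
    · exact hω' w hmem hwS
  let Φ : I → SAW.DomainSAW Ω δ w c := fun p =>
    ⟨SimpleGraph.Walk.cons p.1.2.1 p.2.1.walk,
      (SimpleGraph.Walk.cons_isPath_iff p.1.2.1 p.2.1.walk).2 ⟨p.2.1.isPath, hnotin p⟩⟩
  have hΦinj : Function.Injective Φ := by
    rintro ⟨⟨u, hu⟩, ⟨⟨q, hq⟩, hqS⟩⟩ ⟨⟨u', hu'⟩, ⟨⟨q', hq'⟩, hqS'⟩⟩ h
    simp only [Φ, SAW.DomainSAW.mk.injEq, SimpleGraph.Walk.cons.injEq] at h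
    obtain ⟨rfl, h⟩ := h
    obtain rfl := heq_iff_eq.mp h
    rfl
  -- the summand of the left-hand side and its values on the range of `Φ`
  let F : SAW.DomainSAW Ω δ w c → ℝ := fun ω =>
    if ∀ v ∈ ω.walk.support.tail, v ∉ S then x ^ ω.length else 0
  have hFΦ : ∀ p : I, F (Φ p) = x * x ^ p.2.1.length := by
    rintro ⟨⟨u, hu⟩, ⟨ω', hω'⟩⟩
    have hcond : ∀ v ∈ (SimpleGraph.Walk.cons hu.1 ω'.walk).support.tail, v ∉ S := by
      intro v hv
      rw [SimpleGraph.Walk.support_cons, List.tail_cons, ← SimpleGraph.Walk.cons_tail_support,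
        List.mem_cons] at hv
      rcases hv with rfl | hv
      · exact hu.2
      · exact hω' v hv
    simp only [F, Φ, if_pos hcond, SAW.DomainSAW.length, SimpleGraph.Walk.length_cons, pow_succ']
  have hrange : Function.support F ⊆ Set.range Φ := by
    rintro ⟨p, hp⟩ hω
    rw [Function.mem_support] at hω
    have hcond : ∀ v ∈ p.support.tail, v ∉ S := by
      by_contra hc
      apply hω
      simp only [F]
      exact if_neg hc
    cases p with
    | nil => exact absurd rfl hwc
    | cons h q =>
      have hq : q.IsPath ∧ w ∉ q.support := (SimpleGraph.Walk.cons_isPath_iff h q).1 hp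
      rw [SimpleGraph.Walk.support_cons, List.tail_cons] at hcond
      have htail : ∀ v ∈ q.support.tail, v ∉ S := fun v hv => hcond v (List.mem_of_mem_tail hv)
      have hu : N _ := ⟨h, hcond _ q.start_mem_support⟩
      exact ⟨⟨⟨_, hu⟩, ⟨⟨q, hq.1⟩, htail⟩⟩, rfl⟩
  -- the inner sums over SAWs from `u` avoiding `S` after time 0 are the slit masses `Z u (u :: S)`
  have hinner : ∀ u : N,
      (∑' ω' : {ω' : SAW.DomainSAW Ω δ u.1 c // ∀ v ∈ ω'.walk.support.tail, v ∉ S},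
        x ^ ω'.1.length) = Z u.1 (u.1 :: S) := by
    intro u
    simp only [Z]
    refine (tsum_subtype {ω' : SAW.DomainSAW Ω δ u.1 c | ∀ v ∈ ω'.walk.support.tail, v ∉ S}
      (fun ω' => x ^ ω'.length)).trans ?_
    refine tsum_congr fun ω' => ?_
    simp only [Set.indicator_apply, Set.mem_setOf_eq]
    refine if_congr ?_ rfl rfl
    have hu_tail : u.1 ∉ ω'.walk.support.tail := by
      have hnd := ω'.isPath.support_nodup
      rw [← SimpleGraph.Walk.cons_tail_support] at hnd
      exact (List.nodup_cons.1 hnd).1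
    refine forall₂_congr fun v hv => ?_
    rw [List.mem_cons, not_or]
    exact ⟨fun h => ⟨fun hvu => hu_tail (hvu ▸ hv), h⟩, fun h => h.2⟩
  -- assemble
  show (∑' ω, F ω) = x * ∑ᶠ u ∈ N, Z u (u :: S)
  calc (∑' ω, F ω) = ∑' p : I, F (Φ p) := (hΦinj.tsum_eq hrange).symm
    _ = ∑' p : I, x * x ^ p.2.1.length := tsum_congr hFΦ
    _ = x * ∑' p : I, x ^ p.2.1.length := tsum_mul_left
    _ = x * ∑' u : N, ∑' ω' : {ω' : SAW.DomainSAW Ω δ u.1 c // ∀ v ∈ ω'.walk.support.tail, v ∉ S},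
          x ^ ω'.1.length := by
      rw [Summable.tsum_sigma' (fun u => Summable.of_finite) Summable.of_finite]
    _ = x * ∑' u : N, Z u.1 (u.1 :: S) := by rw [tsum_congr hinner]
    _ = x * ∑ᶠ u ∈ N, Z u (u :: S) := by
      rw [tsum_subtype N (fun u => Z u (u :: S)),
        tsum_eq_finsum (hN.subset (Set.support_indicator_subset)), ← finsum_mem_def]

end SAWLaplacianWalkSlitFirstStep

open scoped Classical in
/-- **`SlitFirstStep` holds** (route SAWLaplacianWalk, stmt-CriticalPhenomena-4484): the first-step
decomposition `Z_{w,S}(c) = x_c · Σ_{u ∼ w, u ∉ S} Z_{u, u::S}(c)` of the slit SAW mass for bounded `Ω`,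
`δ > 0`, `w ∈ S`, `w ≠ c` (Lawler 2005, (0.1) with `q` replaced by the SAW masses `q*`).
[folklore] -/
theorem SlitFirstStep_proof :
    Summit.CriticalPhenomena.SAWScalingLimit.Theses.SAWLaplacianWalk.SlitFirstStep := by
  intro Ω δ w c S Z hΩ hδ hwS hwc
  exact SAWLaplacianWalkSlitFirstStep.tsum_firstStep hΩ hδ hwS hwc

end Summit.CriticalPhenomena.SAWScalingLimit.Theorems
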